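import Summits.QuantumFields.YangMills.Theorems.BalabanUVNodesN09ChartReadAveragingSubmersion
import Literature.MathematicalPhysics.QuantumFieldTheory.Balaban1983to89.T3NestedUnitLaws
import Literature.MathematicalPhysics.QuantumFieldTheory.Balaban1983to89.BlockAveragingEMLProp2
import Literature.MathematicalPhysics.QuantumFieldTheory.Balaban1983to89.B12ContinuousTransportInvarianceOn
import Literature.MathematicalPhysics.QuantumFieldTheory.Balaban1983to89.T3OrbitAverage
import Literature.MathematicalPhysics.QuantumFieldTheory.Balaban1983to89.Node00.CanonicalTransportOfRecord
import Literature.MathematicalPhysics.QuantumFieldTheory.Balaban1983to89.T3ThresholdSmallness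
import HarnessLib

/-!
# `FluctuationComparisonRegPrIntL` · S1aᴴ — THE CUT RENORMALIZATION STEP OF THE T³ RUNS TRANSFORMS A DENSITY CONTINUOUS ON THE
# SMALL-FIELD WINDOW INTO A DENSITY CONTINUOUS ON ALL COARSE FIELDS: the (c)-residual of the one-version door, by INSTANTIATING the
# pub-ymgap cell's local route (node N09) at the T³ step `descend F ℰp j`

Cell `ym3-torus`, FREE px helper seat «width 17» (px17 g20); `--kind proof --supports stmt-QuantumFields-20520 --as helper` (crux
`FluctuationComparisonRegPrIntL`, LINE `Lines/runpair_organ.lean` v18.5′, stub S1aᴴ `stub_runClassMembershipH : RunClassMembershipH`;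
count-neutral).  [UV3] = [Balaban1985UV3] (CMP 102), [I] = [Balaban1987RG1] (CMP 109).

## Why

S1aᴴ asks, at every height `j` of a cut run, for a density `ρ_j` of the level-`j` law `μ_j` w.r.t. `dU_j` that is CONTINUOUS on the
small-field window `{PlaqSmall θ_j}` (conjunct (iv); print: [UV3] p. 263 (c) «the densities are smooth functions on the small-field
domain»), where below the switching height the laws are produced by the CUT step
`μ_j = (descend F ℰp j)_* (μ_{j+1} · sfCut θ_{j+1})` ([UV3] (4)–(6) p. 257 with the small-field restriction, [I] (0.13) p. 254).
UV3-NODE §67.3 ∕ §77 isolated this as the (c)-residual `hreg` of the one-version door (✓`…S1aInvariantVersion`, ✓`…S1aTowerLawInvariance`):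
an input about the push-forward of a continuous density under the (0.4) block averaging.

THAT INPUT IS IN THE TREE, generically: the pub-ymgap cell's node-N09 local route (dag-n09-w4 g5 over dag-n09-w2 g4's gluing door)
✓`BalabanUVNodes.N09ChartReadAveragingSubmersion.exists_continuous_density_avgFun_of_loopSmall` — for ANY `P : Params` (any dimension),
any `N`, level `j → j+1` in the standing range, a closed set `K` of fine configurations inside the loop `α`-guard (`α ≤ 1∕24`,
`α < δ_{SU(N)}`, `157·α < L^{1−d}`) and any measurable bounded `r ≥ 0` vanishing off `K` and continuous at the points of `K`, the
push-forward of `r·Π dU(b)` under `Ū = avgFun expMeanLogSU` has a density CONTINUOUS ON ALL coarse fields (exponential charts of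
`SU(N)`, the chart-read averaging is a `C¹` submersion at every guarded configuration, partition-of-unity gluing).  THIS FILE is the
T³ junction: `descend F ℰp j = fieldShift _ ∘ avgFun expMeanLogSU` (`T3NestedUnitLaws.descend`, `rfl`) at `P := F.P (j+1)`, level
`0 → 1`, `N = 2`; the cut density `r := ρ′·χ` with an ABSTRACT continuous cut `χ ≥ 0` vanishing as soon as one plaquette variable is
farther than `θ′` from `1` (the line's `sfCut θ` is such a `χ` with `θ′ = 24θ∕25`) is continuous at the points of the CLOSED plaquette
guard `K = {∀ p, dist1 U(∂p) ≤ θ′}` whenever `ρ′` is continuous on an open set containing `K`; the loop guard on `K` is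
✓`BlockAveragingEMLProp2.dist1_loopHol_le'` (`((d+2)L)²∕4 · θ′ ≤ α`); `fieldShift` preserves `dU` (✓`T3LevelShift.measurePreserving_fieldShift`).

## What is proved (0 def, 0 sorry; nothing of Bałaban's asserted)

§1 the cut density: `isClosed_plaqGuard`, `cutDensity_nonneg`, `cutDensity_eq_zero_of_not_mem`, `continuousAt_cutDensity`,
`exists_cutDensity_le`, `loopGuard_of_plaqGuard`.  §2 transport through the level identification: `map_withDensity_fieldShift`.
§3 ★★★ `exists_continuous_density_map_descend_cut` — for every `T3Family F`, height `j`, numerics `α ≤ 1∕24`, `α < δ_{SU(2)}`,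
`157·α < (L²)⁻¹`, `0 ≤ θ′`, `(5L)²∕4·θ′ ≤ α`: `∃ g, Continuous g ∧ 0 ≤ g ∧ (dU′·(ρ′χ)).map (descend F ℰp j) = dU_j · g`;
★★★ `exists_continuous_density_cutStep` — the same in S1aᴴ's letters (`μ′ = dU′.withDensity (ofReal ∘ ρ′)` ⟹
`(μ′.withDensity (ofReal ∘ χ)).map (descend F ℰp j) = dU_j.withDensity (ofReal ∘ g)`, `g` continuous, measurable, `≥ 0`, `Node00.regSet dU_j g = univ`).
§4 ★ `exists_cutStep_numerics` — at `θ′ = 24θBal_{j+1}∕25` the numerics hold for all `j ≥ j₀(F, γ, b₀, p₀)` (`θBal_i → 0`, ✓`tendsto_θBal_atTop`).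
§5 the line's cut-off written out (`sfCutExpr_eq_zero`; continuity ∕ non-negativity are px21's ✓`…S1aTowerSfCutDock.continuous_sfCut2425` ∕ `sfCut2425_nonneg`, inlined) and ★★★ `exists_continuous_density_cutStep_sfCut` — the
cut step FULLY PLUGGED at `χ = sfCut θ` (its defining product of clipped ramps), `S = {PlaqSmall θ}`, `θ′ = 24θ∕25`.

## Honest framing

LOCATED, count-neutral junction BY NAME over the pub-ymgap engine; the smallness `(5L)²∕4·θ′ ≤ α ≤ 1∕24`, `α < δ_{SU(2)}`, `157α < L⁻²`
is a HYPOTHESIS of §3 on the window radius, DISCHARGED in §4 at the line's `θ′ = 24θBal_{j+1}∕25` for `j ≥ j₀(F, γ, b₀, p₀)` (fixed `γ`; the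
height `j₀` is NOT shown uniform in `γ ≤ γ₁` here); (i) positivity of the version on the
coarse window, (m) class membership `MemOfRun`, (β) `AnalyticPairWindowAt`, S1a(ᴴ), the five registered stubs, 20520 and `YM3TorusSU2`
are NOT proved here; UV3-NODE §77.5 ∕ §77.8's own (R1)–(R3) programme is SUPERSEDED by this instantiation.  Rung R3 = SU(2) YM₃ on T³
([UV3] Theorem 1's ultraviolet stability) — NOT d = 4, NOT infinite volume, NOT a mass gap, NOT Clay.
-/

noncomputable section

open MeasureTheory Set Function Filter Topology
open scoped ENNReal
open Literature.MathematicalPhysics.QuantumFieldTheory.Balaban1983to89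
open Literature.MathematicalPhysics.QuantumFieldTheory.Balaban1983to89.T3ContinuumYM3Torus
open Literature.MathematicalPhysics.QuantumFieldTheory.Balaban1983to89.T3NestedUnitLaws (descend sitesPerDir_descend)
open Literature.MathematicalPhysics.QuantumFieldTheory.Balaban1983to89.T3UnitLawDensityEML (ℰp)
open Literature.MathematicalPhysics.QuantumFieldTheory.Balaban1983to89.T3LevelShift (fieldShift bondShift measurePreserving_fieldShift
  measurable_fieldShift fieldShift_fieldShift_symm fieldShift_symm_fieldShift)
open Literature.MathematicalPhysics.QuantumFieldTheory.Balaban1983to89.BlockAveraging (avgFun loopHol Idx measurable_avgFun)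
open Literature.MathematicalPhysics.QuantumFieldTheory.Balaban1983to89.BlockAveragingEMLProp2 (dist1_loopHol_le')
open Literature.MathematicalPhysics.QuantumFieldTheory.Balaban1983to89.ExpMeanLog (expMeanLogSU deltaSU measurable_expMeanLogSU_E)
open Literature.MathematicalPhysics.QuantumFieldTheory.Balaban1983to89.B12ContinuousTransportInvarianceOn (continuous_dist1_SU continuous_plaqHol_SU)
open Summit.QuantumFields.YangMills.BalabanUVNodes.N09ChartReadAveragingSubmersion (exists_continuous_density_avgFun_of_loopSmall)
open Literature.MathematicalPhysics.QuantumFieldTheory.Balaban1983to89.T3UnitScaleTilt (θBal)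
open Literature.MathematicalPhysics.QuantumFieldTheory.Balaban1983to89.T3ThresholdSmallness (tendsto_θBal_atTop)

namespace Summit.QuantumFields.YangMills.Theorems.FluctuationComparisonRegPrIntLS1aCutStepContinuousDensity

/-! ## §1  The cut density `r = ρ′·χ` on the closed plaquette guard -/

section Cut

variable {P : Params} {k : ℕ}

/-- **THE CLOSED PLAQUETTE GUARD** `{U | ∀ p, dist1 U(∂p) ≤ θ′}` is closed (finitely many non-strict inequalities of continuous functions).
[cite: Balaban1985UV3, (18) p.260 (bookkeeping)] -/
theorem isClosed_plaqGuard (θ' : ℝ) :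
    IsClosed {U : GaugeField P k ↥(Matrix.specialUnitaryGroup (Fin 2) ℂ) | ∀ p : Plaq P k, dist1 (GaugeField.plaqHol U p) ≤ θ'} := by
  have h : {U : GaugeField P k ↥(Matrix.specialUnitaryGroup (Fin 2) ℂ) | ∀ p : Plaq P k, dist1 (GaugeField.plaqHol U p) ≤ θ'} =
      ⋂ p : Plaq P k, {U | dist1 (GaugeField.plaqHol U p) ≤ θ'} := by
    ext U; simp only [mem_setOf_eq, mem_iInter]
  rw [h]
  exact isClosed_iInter fun p => isClosed_le ((continuous_dist1_SU (N := 2)).comp (continuous_plaqHol_SU (N := 2) p)) continuous_const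

/-- The closed plaquette guard lies inside every open window on which the continuity of `ρ′` is known, as soon as that window contains it
(bookkeeping form used below: `K ⊆ S`). [cite: Balaban1985UV3, (18) p.260 (bookkeeping)] -/
theorem plaqGuard_subset_plaqSmall {θ' θ : ℝ} (h : θ' < θ) :
    {U : GaugeField P k ↥(Matrix.specialUnitaryGroup (Fin 2) ℂ) | ∀ p : Plaq P k, dist1 (GaugeField.plaqHol U p) ≤ θ'} ⊆ {U | PlaqSmall θ U} :=
  fun _ hU p => (hU p).trans_lt h

variable (ρ' χ : GaugeField P k ↥(Matrix.specialUnitaryGroup (Fin 2) ℂ) → ℝ) (θ' : ℝ)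

/-- The cut density vanishes off the closed plaquette guard (the cut `χ` does). [cite: Balaban1985UV3, (5)-(6) p.257 (bookkeeping)] -/
theorem cutDensity_eq_zero_of_not_mem (hχK : ∀ U, (∃ p : Plaq P k, θ' < dist1 (GaugeField.plaqHol U p)) → χ U = 0)
    {U : GaugeField P k ↥(Matrix.specialUnitaryGroup (Fin 2) ℂ)} (hU : U ∉ {U | ∀ p : Plaq P k, dist1 (GaugeField.plaqHol U p) ≤ θ'}) :
    ρ' U * χ U = 0 := by
  simp only [mem_setOf_eq, not_forall, not_le] at hU
  rw [hχK U hU, mul_zero]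

/-- The cut density is non-negative (on the guard both factors are, off the guard it vanishes). [cite: Balaban1985UV3, (5)-(6) p.257 (bookkeeping)] -/
theorem cutDensity_nonneg {S : Set (GaugeField P k ↥(Matrix.specialUnitaryGroup (Fin 2) ℂ))}
    (hKS : {U | ∀ p : Plaq P k, dist1 (GaugeField.plaqHol U p) ≤ θ'} ⊆ S) (hρ0 : ∀ U ∈ S, 0 ≤ ρ' U) (hχ0 : ∀ U, 0 ≤ χ U)
    (hχK : ∀ U, (∃ p : Plaq P k, θ' < dist1 (GaugeField.plaqHol U p)) → χ U = 0) (U : GaugeField P k ↥(Matrix.specialUnitaryGroup (Fin 2) ℂ)) :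
    0 ≤ ρ' U * χ U := by
  by_cases hU : U ∈ {U | ∀ p : Plaq P k, dist1 (GaugeField.plaqHol U p) ≤ θ'}
  · exact mul_nonneg (hρ0 U (hKS hU)) (hχ0 U)
  · rw [cutDensity_eq_zero_of_not_mem ρ' χ θ' hχK hU]

/-- The cut density is continuous at every point of the guard (there `ρ′` is continuous, the guard lying in the open window `S`, and `χ` is continuous).
[cite: Balaban1985UV3, p.263 (c) (bookkeeping)] -/
theorem continuousAt_cutDensity {S : Set (GaugeField P k ↥(Matrix.specialUnitaryGroup (Fin 2) ℂ))} (hS : IsOpen S)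
    (hKS : {U | ∀ p : Plaq P k, dist1 (GaugeField.plaqHol U p) ≤ θ'} ⊆ S) (hρc : ContinuousOn ρ' S) (hχc : Continuous χ)
    {U : GaugeField P k ↥(Matrix.specialUnitaryGroup (Fin 2) ℂ)} (hU : U ∈ {U | ∀ p : Plaq P k, dist1 (GaugeField.plaqHol U p) ≤ θ'}) :
    ContinuousAt (fun U => ρ' U * χ U) U :=
  (hρc.continuousAt (hS.mem_nhds (hKS hU))).mul hχc.continuousAt

/-- The cut density is bounded (the guard is compact, `ρ′` and `χ` are continuous there; off the guard it vanishes).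
[cite: Balaban1985UV3, p.263 (c) (bookkeeping)] -/
theorem exists_cutDensity_le {S : Set (GaugeField P k ↥(Matrix.specialUnitaryGroup (Fin 2) ℂ))} (hS : IsOpen S)
    (hKS : {U | ∀ p : Plaq P k, dist1 (GaugeField.plaqHol U p) ≤ θ'} ⊆ S) (hρc : ContinuousOn ρ' S) (hχc : Continuous χ)
    (hχK : ∀ U, (∃ p : Plaq P k, θ' < dist1 (GaugeField.plaqHol U p)) → χ U = 0) :
    ∃ C₀ : ℝ, ∀ U : GaugeField P k ↥(Matrix.specialUnitaryGroup (Fin 2) ℂ), ρ' U * χ U ≤ C₀ := by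
  haveI : CompactSpace (GaugeField P k ↥(Matrix.specialUnitaryGroup (Fin 2) ℂ)) := T3OrbitAverage.instCompactSpaceGaugeField
  set K := {U : GaugeField P k ↥(Matrix.specialUnitaryGroup (Fin 2) ℂ) | ∀ p : Plaq P k, dist1 (GaugeField.plaqHol U p) ≤ θ'} with hK
  have hKc : IsCompact K := (isClosed_plaqGuard (P := P) (k := k) θ').isCompact
  have hcont : ContinuousOn (fun U => ρ' U * χ U) K := fun U hU =>
    (continuousAt_cutDensity ρ' χ θ' hS hKS hρc hχc hU).continuousWithinAt
  obtain ⟨C, hC⟩ := hKc.bddAbove_image hcont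
  refine ⟨max C 0, fun U => ?_⟩
  by_cases hU : U ∈ K
  · exact (hC (mem_image_of_mem _ hU)).trans (le_max_left _ _)
  · rw [cutDensity_eq_zero_of_not_mem ρ' χ θ' hχK hU]; exact le_max_right _ _

/-- **THE LOOP GUARD FROM THE PLAQUETTE GUARD**: on `{∀ p, dist1 U(∂p) ≤ θ′}` every loop variable of the (0.4) averaging is within
`((d+2)L)²∕4 · θ′` of `1` (✓`BlockAveragingEMLProp2.dist1_loopHol_le'`). [cite: Balaban1987RG1, (0.4) p.253] -/
theorem loopGuard_of_plaqGuard {θ' α : ℝ} (hθ' : 0 ≤ θ') (hθ'α : ((((P.d + 2) * P.L : ℕ) : ℝ) ^ 2 / 4) * θ' ≤ α)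
    {U : GaugeField P k ↥(Matrix.specialUnitaryGroup (Fin 2) ℂ)} (hU : U ∈ {U | ∀ p : Plaq P k, dist1 (GaugeField.plaqHol U p) ≤ θ'})
    (c : PBond P (k + 1)) (i : Idx P) : dist1 (loopHol U c i) ≤ α :=
  (dist1_loopHol_le' hθ' hU c i).trans hθ'α

end Cut

/-! ## §2  Transport of a density through the level identification `fieldShift` -/

section Shift

variable {F : T3Family} {m K j m' K' j' : ℕ}

/-- **`fieldShift` TRANSPORTS DENSITIES**: `(dV′ · d).map (fieldShift h) = dV · (d ∘ fieldShift h.symm)` (`fieldShift h` is a measure-preserving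
relabelling of the bonds with inverse `fieldShift h.symm`). [cite: Balaban1985Averaging, (10) p.19 (bookkeeping)] -/
theorem map_withDensity_fieldShift (h : (F.PP m K).sitesPerDir j = (F.PP m' K').sitesPerDir j')
    (d : GaugeField (F.PP m' K') j' ↥(Matrix.specialUnitaryGroup (Fin 2) ℂ) → ℝ≥0∞) (hd : Measurable d) :
    ((fieldMeasure (F.PP m' K') j' ↥(Matrix.specialUnitaryGroup (Fin 2) ℂ)).withDensity d).map (fieldShift h) =
      (fieldMeasure (F.PP m K) j ↥(Matrix.specialUnitaryGroup (Fin 2) ℂ)).withDensity (d ∘ fieldShift h.symm) := by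
  have hf := measurable_fieldShift (G := ↥(Matrix.specialUnitaryGroup (Fin 2) ℂ)) h
  have hf' := measurable_fieldShift (G := ↥(Matrix.specialUnitaryGroup (Fin 2) ℂ)) h.symm
  ext A hA
  rw [Measure.map_apply hf hA, withDensity_apply _ (hf hA), withDensity_apply _ hA, ← (measurePreserving_fieldShift h).map_eq,
    setLIntegral_map hA (hd.comp hf') hf]
  refine setLIntegral_congr_fun (hf hA) fun U _ => ?_
  simp only [Function.comp_apply, fieldShift_fieldShift_symm]

end Shift

/-! ## §3  The cut step of the T³ runs: a continuous density on ALL coarse fields -/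

section Step

variable (F : T3Family) (j : ℕ)

/-- ★★★ **THE CUT RENORMALIZATION STEP TRANSFORMS A WINDOW-CONTINUOUS DENSITY INTO AN EVERYWHERE-CONTINUOUS ONE.**  `F` a T³ family, `j` a height;
numerics `α ≤ 1∕24`, `α < δ_{SU(2)}`, `157·α < (L²)⁻¹`, `0 ≤ θ′`, `(5L)²∕4 · θ′ ≤ α`; `S` an open set of fine (`= F.P (j+1)`, level-0) configurations containing
the closed plaquette guard `{∀ p, dist1 U(∂p) ≤ θ′}`; `ρ′` measurable, continuous on `S`, `≥ 0` on `S`; `χ` continuous, `≥ 0`, vanishing as soon as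
one plaquette variable is farther than `θ′` from `1`.  THEN the push-forward of `dU′ · (ρ′χ)` under the step `descend F ℰp j` has a density `g`
w.r.t. `dU_j` that is CONTINUOUS ON ALL OF the coarse configuration space, and `≥ 0` — the pub-ymgap engine
✓`exists_continuous_density_avgFun_of_loopSmall` at `P := F.P (j+1)`, level `0 → 1`, `N = 2`, transported through `fieldShift`.
[cite: Balaban1985UV3, (4)-(6) p.257 and p.263 (c); Balaban1987RG1, (0.13) p.254, (2.10) p.267] -/
theorem exists_continuous_density_map_descend_cut {α θ' : ℝ} (hα24 : α ≤ 1 / 24) (hαδ : α < deltaSU (Fin 2))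
    (hαL : 157 * α < (((F.L : ℝ)) ^ 2)⁻¹) (hθ' : 0 ≤ θ') (hθ'α : (((5 * F.L : ℕ) : ℝ) ^ 2 / 4) * θ' ≤ α)
    {S : Set (GaugeField (F.P (j + 1)) 0 ↥(Matrix.specialUnitaryGroup (Fin 2) ℂ))} (hS : IsOpen S)
    (hKS : {U | ∀ p : Plaq (F.P (j + 1)) 0, dist1 (GaugeField.plaqHol U p) ≤ θ'} ⊆ S)
    (ρ' : GaugeField (F.P (j + 1)) 0 ↥(Matrix.specialUnitaryGroup (Fin 2) ℂ) → ℝ) (hρm : Measurable ρ') (hρc : ContinuousOn ρ' S)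
    (hρ0 : ∀ U ∈ S, 0 ≤ ρ' U)
    (χ : GaugeField (F.P (j + 1)) 0 ↥(Matrix.specialUnitaryGroup (Fin 2) ℂ) → ℝ) (hχc : Continuous χ) (hχ0 : ∀ U, 0 ≤ χ U)
    (hχK : ∀ U, (∃ p : Plaq (F.P (j + 1)) 0, θ' < dist1 (GaugeField.plaqHol U p)) → χ U = 0) :
    ∃ g : GaugeField (F.P j) 0 ↥(Matrix.specialUnitaryGroup (Fin 2) ℂ) → ℝ, Continuous g ∧ (∀ V, 0 ≤ g V) ∧
      ((fieldMeasure (F.P (j + 1)) 0 ↥(Matrix.specialUnitaryGroup (Fin 2) ℂ)).withDensity (fun U => ENNReal.ofReal (ρ' U * χ U))).map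
          (descend F ℰp j) =
        (fieldMeasure (F.P j) 0 ↥(Matrix.specialUnitaryGroup (Fin 2) ℂ)).withDensity (fun V => ENNReal.ofReal (g V)) := by
  haveI : BorelSpace (GaugeField (F.P (j + 1)) 0 ↥(Matrix.specialUnitaryGroup (Fin 2) ℂ)) := T3OrbitAverage.instBorelSpaceGaugeField
  haveI : BorelSpace (GaugeField (F.P (j + 1)) (0 + 1) ↥(Matrix.specialUnitaryGroup (Fin 2) ℂ)) := T3OrbitAverage.instBorelSpaceGaugeField
  haveI : BorelSpace (GaugeField (F.P j) 0 ↥(Matrix.specialUnitaryGroup (Fin 2) ℂ)) := T3OrbitAverage.instBorelSpaceGaugeField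
  -- the closed plaquette guard and the cut density
  set K := {U : GaugeField (F.P (j + 1)) 0 ↥(Matrix.specialUnitaryGroup (Fin 2) ℂ) | ∀ p : Plaq (F.P (j + 1)) 0,
    dist1 (GaugeField.plaqHol U p) ≤ θ'} with hK
  have hKc : IsClosed K := isClosed_plaqGuard θ'
  have hθ'α' : (((((F.P (j + 1)).d + 2) * (F.P (j + 1)).L : ℕ) : ℝ) ^ 2 / 4) * θ' ≤ α := hθ'α
  have hKα : ∀ U ∈ K, ∀ (c : PBond (F.P (j + 1)) (0 + 1)) (i : Idx (F.P (j + 1))), dist1 (loopHol U c i) ≤ α :=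
    fun U hU c i => loopGuard_of_plaqGuard hθ' hθ'α' hU c i
  have hαL' : 157 * α < (((F.P (j + 1)).L : ℝ) ^ ((F.P (j + 1)).d - 1))⁻¹ := hαL
  have hj : 0 + 1 ≤ (F.P (j + 1)).m + (F.P (j + 1)).K := by show 0 + 1 ≤ F.m + (j + 1); omega
  -- the engine
  obtain ⟨g₁, hg₁c, hg₁0, hset, -⟩ := exists_continuous_density_avgFun_of_loopSmall (P := F.P (j + 1)) (j := 0) (N := 2) hj hα24 hαδ hαL'
    hKc hKα (fun U => ρ' U * χ U) (hρm.mul hχc.measurable) (cutDensity_nonneg ρ' χ θ' hKS hρ0 hχ0 hχK)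
    (fun U hU => continuousAt_cutDensity ρ' χ θ' hS hKS hρc hχc hU) (exists_cutDensity_le ρ' χ θ' hS hKS hρc hχc hχK)
    (fun U hU => cutDensity_eq_zero_of_not_mem ρ' χ θ' hχK hU)
  -- the measure identity at level `1` of `F.P (j+1)`
  have hAm : Measurable (avgFun (expMeanLogSU (n := Fin 2)) :
      GaugeField (F.P (j + 1)) 0 ↥(Matrix.specialUnitaryGroup (Fin 2) ℂ) → GaugeField (F.P (j + 1)) (0 + 1) ↥(Matrix.specialUnitaryGroup (Fin 2) ℂ)) :=
    measurable_avgFun _ measurable_expMeanLogSU_E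
  have hmap : ((fieldMeasure (F.P (j + 1)) 0 ↥(Matrix.specialUnitaryGroup (Fin 2) ℂ)).withDensity
      (fun U => ENNReal.ofReal (ρ' U * χ U))).map (avgFun (expMeanLogSU (n := Fin 2))) =
      (fieldMeasure (F.P (j + 1)) (0 + 1) ↥(Matrix.specialUnitaryGroup (Fin 2) ℂ)).withDensity (fun V => ENNReal.ofReal (g₁ V)) := by
    ext S' hS'
    rw [Measure.map_apply hAm hS', withDensity_apply _ hS']
    exact hset S' hS'
  -- transport through the level identification
  have hg₁m : Measurable fun V => ENNReal.ofReal (g₁ V) := ENNReal.measurable_ofReal.comp hg₁c.measurable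
  refine ⟨g₁ ∘ fieldShift (sitesPerDir_descend F j 0).symm, hg₁c.comp (continuous_pi fun b => continuous_apply _), fun V => hg₁0 _, ?_⟩
  have hdesc : (descend F ℰp j : GaugeField (F.P (j + 1)) 0 ↥(Matrix.specialUnitaryGroup (Fin 2) ℂ) → _) =
      fieldShift (sitesPerDir_descend F j 0) ∘ avgFun (expMeanLogSU (n := Fin 2)) := rfl
  rw [hdesc]
  calc Measure.map (fieldShift (sitesPerDir_descend F j 0) ∘ avgFun (expMeanLogSU (n := Fin 2)))
        ((fieldMeasure (F.P (j + 1)) 0 ↥(Matrix.specialUnitaryGroup (Fin 2) ℂ)).withDensity (fun U => ENNReal.ofReal (ρ' U * χ U)))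
      = Measure.map (fieldShift (sitesPerDir_descend F j 0)) (Measure.map (avgFun (expMeanLogSU (n := Fin 2)))
        ((fieldMeasure (F.P (j + 1)) 0 ↥(Matrix.specialUnitaryGroup (Fin 2) ℂ)).withDensity (fun U => ENNReal.ofReal (ρ' U * χ U)))) :=
        (Measure.map_map (measurable_fieldShift _) hAm).symm
    _ = Measure.map (fieldShift (sitesPerDir_descend F j 0))
        ((fieldMeasure (F.P (j + 1)) (0 + 1) ↥(Matrix.specialUnitaryGroup (Fin 2) ℂ)).withDensity (fun V => ENNReal.ofReal (g₁ V))) :=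
        congrArg (Measure.map (fieldShift (sitesPerDir_descend F j 0))) hmap
    _ = (fieldMeasure (F.P j) 0 ↥(Matrix.specialUnitaryGroup (Fin 2) ℂ)).withDensity ((fun V => ENNReal.ofReal (g₁ V)) ∘ fieldShift (sitesPerDir_descend F j 0).symm) :=
        map_withDensity_fieldShift _ _ hg₁m
    _ = _ := rfl

/-- ★★★ **THE SAME IN S1aᴴ'S LETTERS.**  If `μ′ = dU′.withDensity (ofReal ∘ ρ′)` with `ρ′` measurable, continuous and `≥ 0` on an open `S` containing
the closed plaquette guard of radius `θ′`, and `χ` is a continuous non-negative cut vanishing as soon as a plaquette variable is farther than `θ′`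
from `1` (the line's `sfCut θ`, `θ′ = 24θ∕25`), then the cut-step law `(μ′.withDensity (ofReal ∘ χ)).map (descend F ℰp j)` has a density
`g` w.r.t. `dU_j` that is CONTINUOUS everywhere, measurable and `≥ 0` — conjunct (iv) of S1aᴴ at height `j` with room to spare, the
measurability needed to iterate, and `Node00.regSet dU_j g = univ` (so the one-version door's binder `hreg` of ✓`…S1aTowerLawInvariance.exists_invariantVersion`
holds for EVERY open window at the cut heights). [cite: Balaban1985UV3, (4)-(6) p.257 and p.263 (c); Balaban1987RG1, (0.13) p.254] -/
theorem exists_continuous_density_cutStep {α θ' : ℝ} (hα24 : α ≤ 1 / 24) (hαδ : α < deltaSU (Fin 2))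
    (hαL : 157 * α < (((F.L : ℝ)) ^ 2)⁻¹) (hθ' : 0 ≤ θ') (hθ'α : (((5 * F.L : ℕ) : ℝ) ^ 2 / 4) * θ' ≤ α)
    {S : Set (GaugeField (F.P (j + 1)) 0 ↥(Matrix.specialUnitaryGroup (Fin 2) ℂ))} (hS : IsOpen S)
    (hKS : {U | ∀ p : Plaq (F.P (j + 1)) 0, dist1 (GaugeField.plaqHol U p) ≤ θ'} ⊆ S)
    {ρ' : GaugeField (F.P (j + 1)) 0 ↥(Matrix.specialUnitaryGroup (Fin 2) ℂ) → ℝ} (hρm : Measurable ρ') (hρc : ContinuousOn ρ' S)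
    (hρ0 : ∀ U ∈ S, 0 ≤ ρ' U)
    {μ' : Measure (GaugeField (F.P (j + 1)) 0 ↥(Matrix.specialUnitaryGroup (Fin 2) ℂ))}
    (hμ' : μ' = (fieldMeasure _ _ _).withDensity (fun U => ENNReal.ofReal (ρ' U)))
    {χ : GaugeField (F.P (j + 1)) 0 ↥(Matrix.specialUnitaryGroup (Fin 2) ℂ) → ℝ} (hχc : Continuous χ) (hχ0 : ∀ U, 0 ≤ χ U)
    (hχK : ∀ U, (∃ p : Plaq (F.P (j + 1)) 0, θ' < dist1 (GaugeField.plaqHol U p)) → χ U = 0) :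
    ∃ g : GaugeField (F.P j) 0 ↥(Matrix.specialUnitaryGroup (Fin 2) ℂ) → ℝ, Continuous g ∧ Measurable g ∧ (∀ V, 0 ≤ g V) ∧
      Measure.map (descend F ℰp j) (μ'.withDensity (fun U => ENNReal.ofReal (χ U))) =
        (fieldMeasure _ _ _).withDensity (fun V => ENNReal.ofReal (g V)) ∧
      Node00.regSet (fieldMeasure (F.P j) 0 ↥(Matrix.specialUnitaryGroup (Fin 2) ℂ)) g = univ := by
  haveI : BorelSpace (GaugeField (F.P (j + 1)) 0 ↥(Matrix.specialUnitaryGroup (Fin 2) ℂ)) := T3OrbitAverage.instBorelSpaceGaugeField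
  haveI : BorelSpace (GaugeField (F.P j) 0 ↥(Matrix.specialUnitaryGroup (Fin 2) ℂ)) := T3OrbitAverage.instBorelSpaceGaugeField
  obtain ⟨g, hgc, hg0, hmap⟩ := exists_continuous_density_map_descend_cut F j hα24 hαδ hαL hθ' hθ'α hS hKS ρ' hρm hρc hρ0 χ hχc hχ0 hχK
  refine ⟨g, hgc, hgc.measurable, hg0, ?_, Node00.regSet_eq_univ_of_hasContVersion ⟨g, hgc, Filter.EventuallyEq.rfl⟩⟩
  have hf : Measurable fun U : GaugeField (F.P (j + 1)) 0 ↥(Matrix.specialUnitaryGroup (Fin 2) ℂ) => ENNReal.ofReal (ρ' U) :=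
    ENNReal.measurable_ofReal.comp hρm
  have hg : Measurable fun U : GaugeField (F.P (j + 1)) 0 ↥(Matrix.specialUnitaryGroup (Fin 2) ℂ) => ENNReal.ofReal (χ U) :=
    ENNReal.measurable_ofReal.comp hχc.measurable
  have hprod : ((fun U : GaugeField (F.P (j + 1)) 0 ↥(Matrix.specialUnitaryGroup (Fin 2) ℂ) => ENNReal.ofReal (ρ' U)) * fun U => ENNReal.ofReal (χ U)) =
      fun U => ENNReal.ofReal (ρ' U * χ U) := by
    funext U
    simp only [Pi.mul_apply]
    by_cases hU : U ∈ {U | ∀ p : Plaq (F.P (j + 1)) 0, dist1 (GaugeField.plaqHol U p) ≤ θ'}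
    · rw [ENNReal.ofReal_mul (hρ0 U (hKS hU))]
    · have h0 : χ U = 0 := by
        simp only [mem_setOf_eq, not_forall, not_le] at hU
        exact hχK U hU
      rw [h0, mul_zero, ENNReal.ofReal_zero, mul_zero]
  rw [← hmap, hμ', ← withDensity_mul _ hf hg, hprod]

end Step

/-! ## §4  The numerics hold at Bałaban's thresholds from some height on -/

section Numerics

/-- ★ **THE WINDOW RADII `θ′ = 24θBal_{j+1}∕25` SATISFY THE ENGINE'S NUMERICS FROM SOME HEIGHT ON** (fixed `0 < γ ≤ 1`, `b₀ > 0`): there is an `α` with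
`α ≤ 1∕24`, `α < δ_{SU(2)}`, `157·α < (L²)⁻¹` and a height `j₀` such that for all `j ≥ j₀`, `0 ≤ 24θBal_{j+1}∕25` and `(5L)²∕4 · (24θBal_{j+1}∕25) ≤ α`
(the thresholds vanish in the ultraviolet, ✓`T3ThresholdSmallness.tendsto_θBal_atTop`). [cite: Balaban1985UV3, (3) p.256 and (7) p.257] -/
theorem exists_cutStep_numerics (F : T3Family) {γ b₀ : ℝ} (hγ : 0 < γ) (hγ1 : γ ≤ 1) (hb : 0 < b₀) (p₀ : ℝ) :
    ∃ α : ℝ, α ≤ 1 / 24 ∧ α < deltaSU (Fin 2) ∧ 157 * α < (((F.L : ℝ)) ^ 2)⁻¹ ∧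
      ∃ j₀ : ℕ, ∀ j : ℕ, j₀ ≤ j →
        0 ≤ 24 / 25 * θBal F.L γ b₀ p₀ (j + 1) ∧ (((5 * F.L : ℕ) : ℝ) ^ 2 / 4) * (24 / 25 * θBal F.L γ b₀ p₀ (j + 1)) ≤ α := by
  have hL1 : 1 < F.L := F.hL.2
  have hLpos : (0 : ℝ) < ((F.L : ℝ)) ^ 2 := by positivity
  have hδ : 0 < deltaSU (Fin 2) := ExpMeanLog.deltaSU_pos
  set α : ℝ := min (1 / 24) (min (deltaSU (Fin 2) / 2) ((((F.L : ℝ)) ^ 2)⁻¹ / 158)) with hα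
  have hαpos : 0 < α := by
    rw [hα]; exact lt_min (by norm_num) (lt_min (by linarith) (by positivity))
  refine ⟨α, min_le_left _ _, ?_, ?_, ?_⟩
  · exact (min_le_right _ _).trans_lt ((min_le_left _ _).trans_lt (by linarith))
  · have h1 : α ≤ (((F.L : ℝ)) ^ 2)⁻¹ / 158 := (min_le_right _ _).trans (min_le_right _ _)
    have h2 : 0 < (((F.L : ℝ)) ^ 2)⁻¹ := inv_pos.2 hLpos
    nlinarith
  · -- the thresholds are eventually below `α ∕ C`, `C = (5L)²∕4 · 24∕25 + 1`
    set C : ℝ := (((5 * F.L : ℕ) : ℝ) ^ 2 / 4) * (24 / 25) + 1 with hC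
    have hCpos : 0 < C := by rw [hC]; positivity
    have hev : ∀ᶠ i : ℕ in atTop, θBal F.L γ b₀ p₀ i < α / C :=
      (tendsto_θBal_atTop hL1 hγ b₀ p₀).eventually_lt_const (div_pos hαpos hCpos)
    obtain ⟨j₀, hj₀⟩ := eventually_atTop.1 hev
    refine ⟨j₀, fun j hj => ?_⟩
    have hθpos : 0 < θBal F.L γ b₀ p₀ (j + 1) := T3MinimiserStabilityReduction.θBal_pos hL1.le hγ hγ1 hb p₀ (j + 1)
    have hθ : θBal F.L γ b₀ p₀ (j + 1) < α / C := hj₀ (j + 1) (by omega)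
    refine ⟨by positivity, ?_⟩
    have hθC : C * θBal F.L γ b₀ p₀ (j + 1) ≤ α := by
      have := (lt_div_iff₀ hCpos).1 hθ
      linarith [this]
    calc (((5 * F.L : ℕ) : ℝ) ^ 2 / 4) * (24 / 25 * θBal F.L γ b₀ p₀ (j + 1))
        = ((((5 * F.L : ℕ) : ℝ) ^ 2 / 4) * (24 / 25)) * θBal F.L γ b₀ p₀ (j + 1) := by ring
      _ ≤ C * θBal F.L γ b₀ p₀ (j + 1) := by
          refine mul_le_mul_of_nonneg_right ?_ hθpos.le
          rw [hC]; linarith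
      _ ≤ α := hθC

end Numerics

/-! ## §5  Plugging the line's smooth small-field cut-off (its defining expression, written out) -/

section SfCut

variable {P : Params} {k : ℕ}

/-- The line's cut-off `sfCut θ U = ∏_p max 0 (min 1 ((24θ∕25 − dist1 U(∂p)) ∕ ((24∕25 − 1∕2)θ)))` (written out; `Lines/runpair_organ.lean`'s `sfCut`
unfolds to it; continuity and non-negativity are px21's ✓`…S1aTowerSfCutDock.continuous_sfCut2425` ∕ `sfCut2425_nonneg`) VANISHES as soon as one plaquette
variable is farther than `24θ∕25` from `1` (`θ > 0`). [cite: Balaban1985UV3, (5)-(6) p.257 (bookkeeping)] -/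
theorem sfCutExpr_eq_zero {θ : ℝ} (hθ : 0 < θ) (U : GaugeField P k ↥(Matrix.specialUnitaryGroup (Fin 2) ℂ))
    (h : ∃ p : Plaq P k, 24 / 25 * θ < dist1 (GaugeField.plaqHol U p)) :
    ∏ p : Plaq P k, max 0 (min 1 ((24 / 25 * θ - dist1 (GaugeField.plaqHol U p)) / ((24 / 25 - 1 / 2) * θ))) = 0 := by
  obtain ⟨p, hp⟩ := h
  refine Finset.prod_eq_zero (Finset.mem_univ p) ?_
  have hneg : (24 / 25 * θ - dist1 (GaugeField.plaqHol U p)) / ((24 / 25 - 1 / 2) * θ) < 0 :=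
    div_neg_of_neg_of_pos (by linarith) (by linarith)
  rw [max_eq_left_iff]
  exact (min_le_right _ _).trans hneg.le

/-- ★★★ **THE CUT STEP AT THE LINE'S CUT-OFF, FULLY PLUGGED**: `θ > 0` with the numerics at `θ′ = 24θ∕25`; `μ′ = dU′.withDensity (ofReal ∘ ρ′)` with `ρ′`
measurable, continuous and `≥ 0` on the window `{PlaqSmall θ}` ⟹ the law `(μ′ · sfCut θ).map (descend F ℰp j)` has a density continuous everywhere, measurable,
`≥ 0`, with `Node00.regSet = univ`. [cite: Balaban1985UV3, (4)-(6) p.257 and p.263 (c); Balaban1987RG1, (0.13) p.254] -/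
theorem exists_continuous_density_cutStep_sfCut (F : T3Family) (j : ℕ) {α θ : ℝ} (hθ : 0 < θ) (hα24 : α ≤ 1 / 24)
    (hαδ : α < deltaSU (Fin 2)) (hαL : 157 * α < (((F.L : ℝ)) ^ 2)⁻¹) (hθα : (((5 * F.L : ℕ) : ℝ) ^ 2 / 4) * (24 / 25 * θ) ≤ α)
    {ρ' : GaugeField (F.P (j + 1)) 0 ↥(Matrix.specialUnitaryGroup (Fin 2) ℂ) → ℝ} (hρm : Measurable ρ')
    (hρc : ContinuousOn ρ' {U | PlaqSmall θ U}) (hρ0 : ∀ U, PlaqSmall θ U → 0 ≤ ρ' U)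
    {μ' : Measure (GaugeField (F.P (j + 1)) 0 ↥(Matrix.specialUnitaryGroup (Fin 2) ℂ))}
    (hμ' : μ' = (fieldMeasure _ _ _).withDensity (fun U => ENNReal.ofReal (ρ' U))) :
    ∃ g : GaugeField (F.P j) 0 ↥(Matrix.specialUnitaryGroup (Fin 2) ℂ) → ℝ, Continuous g ∧ Measurable g ∧ (∀ V, 0 ≤ g V) ∧
      Measure.map (descend F ℰp j) (μ'.withDensity (fun U => ENNReal.ofReal
        (∏ p : Plaq (F.P (j + 1)) 0, max 0 (min 1 ((24 / 25 * θ - dist1 (GaugeField.plaqHol U p)) / ((24 / 25 - 1 / 2) * θ)))))) =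
        (fieldMeasure _ _ _).withDensity (fun V => ENNReal.ofReal (g V)) ∧
      Node00.regSet (fieldMeasure (F.P j) 0 ↥(Matrix.specialUnitaryGroup (Fin 2) ℂ)) g = univ := by
  have hopen : IsOpen {U : GaugeField (F.P (j + 1)) 0 ↥(Matrix.specialUnitaryGroup (Fin 2) ℂ) | PlaqSmall θ U} := by
    have h : {U : GaugeField (F.P (j + 1)) 0 ↥(Matrix.specialUnitaryGroup (Fin 2) ℂ) | PlaqSmall θ U} =
        ⋂ p : Plaq (F.P (j + 1)) 0, {U | dist1 (GaugeField.plaqHol U p) < θ} := by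
      ext U; simp only [PlaqSmall, mem_setOf_eq, mem_iInter]
    rw [h]
    exact isOpen_iInter_of_finite fun p =>
      isOpen_lt ((continuous_dist1_SU (N := 2)).comp (continuous_plaqHol_SU (N := 2) p)) continuous_const
  -- continuity and non-negativity of the cut-off (px21's ✓`…S1aTowerSfCutDock.continuous_sfCut2425` ∕ `sfCut2425_nonneg`, inlined to keep the imports light)
  have hχc : Continuous fun U : GaugeField (F.P (j + 1)) 0 ↥(Matrix.specialUnitaryGroup (Fin 2) ℂ) =>
      ∏ p : Plaq (F.P (j + 1)) 0, max 0 (min 1 ((24 / 25 * θ - dist1 (GaugeField.plaqHol U p)) / ((24 / 25 - 1 / 2) * θ))) :=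
    continuous_finsetProd _ fun p _ => continuous_const.max (continuous_const.min
      ((continuous_const.sub ((continuous_dist1_SU (N := 2)).comp (continuous_plaqHol_SU (N := 2) p))).div_const _))
  have hχ0 : ∀ U : GaugeField (F.P (j + 1)) 0 ↥(Matrix.specialUnitaryGroup (Fin 2) ℂ),
      0 ≤ ∏ p : Plaq (F.P (j + 1)) 0, max 0 (min 1 ((24 / 25 * θ - dist1 (GaugeField.plaqHol U p)) / ((24 / 25 - 1 / 2) * θ))) :=
    fun U => Finset.prod_nonneg fun _ _ => le_max_left _ _
  exact exists_continuous_density_cutStep F j hα24 hαδ hαL (by linarith) hθα hopen (plaqGuard_subset_plaqSmall (by linarith)) hρm hρc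
    (fun U hU => hρ0 U hU) hμ' hχc hχ0 (fun U hU => sfCutExpr_eq_zero hθ U hU)

end SfCut

end Summit.QuantumFields.YangMills.Theorems.FluctuationComparisonRegPrIntLS1aCutStepContinuousDensity

end
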